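import Mathlib
import Literature.MathematicalPhysics.QuantumFieldTheory.Balaban1983to89.B5Block118

/-!
# B5 (1.6): «we divide T₁ into blocks B(y) parametrized by the points of T_L^{(1)}» — the blocks
# `B^k(y)` PARTITION the `η`-torus

Source: T. Bałaban, *Propagators and renormalization transformations for lattice gauge
theories. I*, Commun. Math. Phys. 95 (1984) 17–40 (`Balaban1984PropagatorsI`, "B5"), render
`b2b-balaban-ref1/pages/1984-cmp95-propagators-rt-I/…-p002-x2.png` (p. 18), read as an image.

## What the paper prints (verbatim, p. 18 [PDF 2])

«Now let us define a renormalization group transformation. We define a new lattice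
T_L^{(1)} = T₁ ∩ Lℤ^d and we divide T₁ into blocks B(y) parametrized by the points of T_L^{(1)}:
B(y) = {x ∈ T₁ : y_μ ≦ x_μ < y_μ + L, μ = 1, …, d}, y ∈ T_L^{(1)}. (1.6)»
(and p. 20: «Q₂ is defined as Q only with the number L replaced by L² in all definitions», whence
the blocks `B^k(y)`, `y ∈ T₁^{(k)}`, of (1.18) with `L` replaced by `L^k = n = η⁻¹`).

## What is typed and certified here

`B5Block118` DEFINES the block `B^k(y)` as the image `{bpt y j = n·y + j : j ∈ {0,…,n−1}^d}` and
lists as NOT certified that these images partition `T_η = Tor (fine n M)`.  This module certifies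
it: `bpt_val` (the fine coordinate of `n·y + j` is the integer `n·v(y_ν) + j_ν < n·M_ν` — i.e.
«y_μ ≦ x_μ < y_μ + 1» in `η`-units), `bpt_injective`, `bpt_bijective` («we divide T₁ into blocks
B(y) parametrized by the points of T_L^{(1)}»: every fine site lies in exactly one block, at
exactly one offset), the block decomposition of sums `sum_blocks`
(`Σ_{x∈T_η} F(x) = Σ_{y∈T₁^{(k)}} Σ_{x∈B^k(y)} F(x)`), and two consequences for the printed
averaging operator `Q′_k` of (1.20): `QsOp_blockConst` (`Q′_k` of a function constant on blocks
returns that function) and `sum_QsOp` (`Σ_y (Q′_k f)(y) = η^d Σ_x f(x)`).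

## What is NOT certified here

Anything about `Q_k` beyond `B5Block118`; fields complex.
-/

open scoped BigOperators Matrix ComplexConjugate
open Finset Complex

namespace Literature.MathematicalPhysics.QuantumFieldTheory.Balaban1983to89.B5Blocks16

open Literature.MathematicalPhysics.QuantumFieldTheory.Balaban1983to89.B5Prop11Plancherel
open Literature.MathematicalPhysics.QuantumFieldTheory.Balaban1983to89.B5Block118

noncomputable section

variable {d : ℕ} (n : ℕ) [NeZero n] (M : Fin d → ℕ) [hM : ∀ μ, NeZero (M μ)]

omit [NeZero n] in
/-- the integer bound «y_μ ≦ x_μ < y_μ + 1» in `η`-units: `n·v(y_ν) + j_ν < n·M_ν`. [folklore] -/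
theorem digits_lt (y : Tor M) (j : Fin d → Fin n) (ν : Fin d) :
    n * (y ν).val + (j ν : ℕ) < fine n M ν := by
  have h1 : n * ((y ν).val + 1) ≤ n * M ν := Nat.mul_le_mul_left n (ZMod.val_lt (y ν))
  have h2 : (j ν : ℕ) < n := (j ν).is_lt
  rw [mul_add_one] at h1
  show n * (y ν).val + (j ν : ℕ) < n * M ν
  omega

omit [NeZero n] in
/-- the block point `n·y + j` as an element of `ℤ/(nM_ν)` is the class of the integer
`n·v(y_ν) + j_ν`. [cite: Balaban1984PropagatorsI, (1.6) p.18] -/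
theorem bpt_eq_natCast (y : Tor M) (j : Fin d → Fin n) (ν : Fin d) :
    bpt n M y j ν = ((n * (y ν).val + (j ν : ℕ) : ℕ) : ZMod (fine n M ν)) := by
  have hy : y ν = (((y ν).val : ℤ) : ZMod (M ν)) := by
    rw [Int.cast_natCast, ZMod.natCast_zmod_val]
  have hup : up n M y ν = (n : ZMod (fine n M ν)) * (((y ν).val : ℤ) : ZMod (fine n M ν)) := by
    show upHom n M ν (y ν) = _
    conv_lhs => rw [hy]
    exact upHom_intCast n M ν _
  show up n M y ν + iota n M j ν = _
  rw [hup, iota]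
  push_cast
  ring

omit [NeZero n] in
/-- the fine coordinate of the block point: `v(x_ν) = n·v(y_ν) + j_ν` («y_μ ≦ x_μ < y_μ + 1»).
[cite: Balaban1984PropagatorsI, (1.6) p.18] -/
theorem bpt_val (y : Tor M) (j : Fin d → Fin n) (ν : Fin d) :
    (bpt n M y j ν).val = n * (y ν).val + (j ν : ℕ) := by
  rw [bpt_eq_natCast, ZMod.val_cast_of_lt (digits_lt n M y j ν)]

/-- distinct (block, offset) pairs give distinct fine sites. [cite: Balaban1984PropagatorsI, (1.6) p.18] -/
theorem bpt_injective :
    Function.Injective (fun yj : Tor M × (Fin d → Fin n) => bpt n M yj.1 yj.2) := by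
  have hn : 0 < n := Nat.pos_of_ne_zero (NeZero.ne n)
  rintro ⟨y, j⟩ ⟨y', j'⟩ h
  simp only at h
  have hν : ∀ ν, (y ν).val = (y' ν).val ∧ (j ν : ℕ) = (j' ν : ℕ) := by
    intro ν
    have hv : n * (y ν).val + (j ν : ℕ) = n * (y' ν).val + (j' ν : ℕ) := by
      rw [← bpt_val, ← bpt_val, h]
    have hmod := congrArg (· % n) hv
    have hdiv := congrArg (· / n) hv
    simp only [Nat.mul_add_mod, Nat.mod_eq_of_lt (j ν).is_lt, Nat.mod_eq_of_lt (j' ν).is_lt] at hmod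
    simp only [Nat.mul_add_div hn, Nat.div_eq_of_lt (j ν).is_lt, Nat.div_eq_of_lt (j' ν).is_lt,
      add_zero] at hdiv
    exact ⟨hdiv, hmod⟩
  refine Prod.ext (funext fun ν => ZMod.val_injective _ (hν ν).1) (funext fun ν => Fin.ext (hν ν).2)

/-- `|T₁^{(k)} × {0,…,n−1}^d| = |T_η|`. [folklore] -/
theorem card_yj : Fintype.card (Tor M × (Fin d → Fin n)) = Fintype.card (Tor (fine n M)) := by
  rw [← card_kq n M, Fintype.card_prod, Fintype.card_prod, mul_comm]

/-- (1.6): «we divide T₁ into blocks B(y) parametrized by the points of T_L^{(1)}» — every fine site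
is `n·y + j` for exactly one unit-lattice point `y` and one offset `j ∈ {0,…,n−1}^d`.
[cite: Balaban1984PropagatorsI, (1.6) p.18] -/
theorem bpt_bijective :
    Function.Bijective (fun yj : Tor M × (Fin d → Fin n) => bpt n M yj.1 yj.2) :=
  (Fintype.bijective_iff_injective_and_card _).mpr ⟨bpt_injective n M, card_yj n M⟩

/-- the partition of sums over `T_η` into blocks: `Σ_{x∈T_η} F(x) = Σ_y Σ_{x∈B^k(y)} F(x)`.
[cite: Balaban1984PropagatorsI, (1.6) p.18] -/
theorem sum_blocks (F : Tor (fine n M) → ℂ) :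
    ∑ x, F x = ∑ y : Tor M, ∑ j : Fin d → Fin n, F (bpt n M y j) := by
  rw [← (bpt_bijective n M).sum_comp F, Fintype.sum_prod_type]

/-- the block of a fine site: the unique `y` with `x ∈ B^k(y)`. [cite: Balaban1984PropagatorsI, (1.6) p.18] -/
def blockOf (x : Tor (fine n M)) : Tor M :=
  ((Equiv.ofBijective _ (bpt_bijective n M)).symm x).1

/-- `n·y + j` lies in the block of `y`. [cite: Balaban1984PropagatorsI, (1.6) p.18] -/
theorem blockOf_bpt (y : Tor M) (j : Fin d → Fin n) : blockOf n M (bpt n M y j) = y := by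
  have h : (Equiv.ofBijective _ (bpt_bijective n M)).symm (bpt n M y j) = (y, j) :=
    (Equiv.ofBijective _ (bpt_bijective n M)).symm_apply_apply (y, j)
  rw [blockOf, h]

/-- `Q′_k` of a function constant on blocks is that function: `(Q′_k (g ∘ blockOf))(y) = g(y)`
(`η^d · n^d = 1`). [cite: Balaban1984PropagatorsI, (1.20) p.20] -/
theorem QsOp_blockConst (g : Tor M → ℂ) :
    QsOp n M *ᵥ (fun x => g (blockOf n M x)) = g := by
  have hnc : (n : ℂ) ≠ 0 := by exact_mod_cast NeZero.ne n
  funext y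
  rw [QsOp_mulVec]
  simp only [blockOf_bpt, Finset.sum_const, Finset.card_univ, Fintype.card_pi, Fintype.card_fin,
    Finset.prod_const, nsmul_eq_mul]
  push_cast
  field_simp

/-- `Σ_y (Q′_k f)(y) = η^d Σ_{x∈T_η} f(x)` (the blocks exhaust `T_η`).
[cite: Balaban1984PropagatorsI, (1.20) p.20] -/
theorem sum_QsOp (f : Tor (fine n M) → ℂ) :
    ∑ y, (QsOp n M *ᵥ f) y = 1 / (n : ℂ) ^ d * ∑ x, f x := by
  simp only [QsOp_mulVec]
  rw [← Finset.mul_sum, sum_blocks n M f]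

end

end Literature.MathematicalPhysics.QuantumFieldTheory.Balaban1983to89.B5Blocks16
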